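import Summits.Ventures.YMGap.RobustBall.HeatBathConcentrationDLR
import Summits.Ventures.YMGap.RobustBall.HeatBathPoincareZdBallDLR
import HarnessLib

/-!
# Robust ball (Y2) — EXPONENTIAL CONCENTRATION OF LOCAL OBSERVABLES IN EVERY INFINITE-VOLUME GIBBS STATE OF EVERY MEMBER OF THE `ℤ^d` BALL

HONEST FRAMING: venture file of the cell `pub-ymgap` (QuantumFields programme), track ROBUST-BALL, seat rb-p2 (g14); the BALL-UNIFORM cells of
`HeatBathConcentrationDLR.lean` (abstract Gibbs-state Gromov–Milman ∕ Aida–Stroock route) fed with the member's heat-bath Poincaré inequality of every DLR state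
(`HeatBathPoincareZd.gibbsVariance_le_onBall`).  LATTICE statements at STRONG COUPLING for the DLR states `μ ∈ 𝒢(γ^W)` of the perturbed specifications
`γ^W = perturbedYM χ_N (Nβ) W supp` of the MEMBERS of rb-p1's `ℤ^d` ball (continuous own-link terms, support `supp` of range `R`, per-link loads `a`, `ℓ_s`, row `Λ`,
column `Λc`); ONE rate for the whole ball; nothing about `β → ∞`, the continuum or Clay.
* ★★★ `gibbs_measureReal_deviation_ge_le_onBall` ∕ `…_le_le_onBall` — `OneLinkKRModulus N b K` on `b ≥ 2(d−1)|β|`, column condition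
  `6(d−1)|β|K e^{a}(1 + 2√N ℓ_s) + √N Λc ≤ c < 1`, row condition `… + √N Λ < 1`: for EVERY member, EVERY DLR state `μ ∈ 𝒢(γ^W)`, every Lipschitz cylinder `F` on the
  links `Δ` with link oscillations `δ_x` (`∑ δ_x² > 0`) and every `r`, `μ{±(F − E_μ F) ≥ r} ≤ e^{2/3} exp(−r / √(2(2(1 − c))⁻¹ ∑_{x∈Δ} δ_x²))`;
* ★★ `su2_gibbs_measureReal_deviation_ge_le_onBall_quarter` ∕ `…_le_le_onBall_quarter` — `SU(2)`, every `d`, quarter modulus (tree coupling `β_W/2`):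
  `c = (3/2)(d−1)β_W e^{a}(1 + 2√2 ℓ_s) + √2 Λc`.
0 sorry, 0 definitions.  References: S. Aida, D. Stroock, Math. Res. Lett. 1 (1994) 75; M. Ledoux (AMS 2001) §3.1; C. Külske, CMP 239 (2003) 29.
Everything here is proved. [folklore]
-/

noncomputable section

open MeasureTheory Function Real Finset ProbabilityTheory Filter Topology
open scoped NNReal
open Summit.QuantumFields.YangMills.Theorems.StrongPinningPoincare
open Literature.Probability.LatticeModels Literature.Probability.LatticeModels.DobrushinMetric
open Literature.MathematicalPhysics.QuantumLattice hiding torusNorm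
open Literature.MathematicalPhysics.QuantumFieldTheory hiding ZdEdge
open Literature.MathematicalPhysics.QuantumFieldTheory.Balaban1983to89.StrongCouplingDobrushinWindow (OneLinkKRModulus)

namespace Summit.Ventures.YMGap.RobustBall.HeatBathConcentration

variable {d N : ℕ}

/-- ★★★ **EXPONENTIAL CONCENTRATION IN EVERY GIBBS STATE OF EVERY MEMBER OF THE `ℤ^d` BALL, upper tail** (`SU(N)`, 't Hooft `β`; member data as in
`HeatBathPoincareZd.gibbsVariance_le_onBall`): `μ{F − E_μ F ≥ r} ≤ e^{2/3} exp(−r / √(2(2(1 − c))⁻¹ ∑_{x∈Δ} δ_x²))` for every DLR state `μ ∈ 𝒢(γ^W)`, every Lipschitz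
cylinder `F` on `Δ` with link oscillations `δ_x` and every `r`. [folklore] -/
theorem gibbs_measureReal_deviation_ge_le_onBall (hd : 1 ≤ d) (hN : 1 ≤ N) {β b K a ℓs Λ Λc R c : ℝ} (hK : 0 ≤ K) (hℓs : 0 ≤ ℓs)
    (hb : |β| * (2 * ((d : ℝ) - 1)) ≤ b) (hmod : OneLinkKRModulus N b K)
    {W : Potential (ZdEdge d) (Matrix.specialUnitaryGroup (Fin N) ℂ)} (hWc : ∀ X, Continuous (W X))
    (hWdep : ∀ X, DependsOn (W X) (↑X : Set (ZdEdge d)))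
    {supp : Finset (ZdEdge d) → Finset (Finset (ZdEdge d))} (hsupp : W.IsSupportedBy supp)
    {osc : Finset (ZdEdge d) → ZdEdge d → ℝ} (hosc : ∀ X, Dobrushin.IsOscBound (W X) (osc X))
    (hosca : ∀ e, ∑ X ∈ (supp {e}).filter (fun X => e ∈ X), osc X e ≤ a)
    {lip : Finset (ZdEdge d) → ZdEdge d → ℝ} (hlip : ∀ X, IsLipBound suFrobDist (W X) (lip X))
    (hlips : ∀ e, ∑ X ∈ (supp {e}).filter (fun X => e ∈ X), lip X e ≤ ℓs)
    (hΛ : ∀ e, ∑ y ∈ perturbedNbr supp e, ∑ X ∈ (supp {e}).filter (fun X => e ∈ X), lip X y ≤ Λ)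
    (hcol : ∀ (y : ZdEdge d) (T : Finset (ZdEdge d)), y ∉ T → ∑ e ∈ T, ∑ X ∈ (supp {e}).filter (fun X => e ∈ X), lip X y ≤ Λc)
    (hR : ∀ e, ∀ X ∈ supp {e}, e ∈ X → ∀ y ∈ X, ‖e.1 - y.1‖ ≤ R)
    (hc : 6 * ((d : ℝ) - 1) * |β| * (K * exp a * (1 + 2 * Real.sqrt N * ℓs)) + Real.sqrt N * Λc ≤ c) (hc1 : c < 1)
    (hrow : 6 * ((d : ℝ) - 1) * |β| * (K * exp a * (1 + 2 * Real.sqrt N * ℓs)) + Real.sqrt N * Λ < 1)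
    {μ : Measure (LGConfig d (Matrix.specialUnitaryGroup (Fin N) ℂ))}
    (hμ : μ ∈ perturbedGibbsMeasures (d := d) (fundamentalRep (Fin N)) (N * β) W supp)
    {F : LGConfig d (Matrix.specialUnitaryGroup (Fin N) ℂ) → ℝ} {Δ : Finset (ZdEdge d)} {KF : ℝ≥0}
    (hF : IsLipschitzCylinder (fundamentalRep (Fin N)) F Δ KF) (δ : ZdEdge d → ℝ)
    (hδ : ∀ x ∈ Δ, ∀ U s, |F U - F (update U x s)| ≤ δ x) (hD : 0 < ∑ x ∈ Δ, δ x ^ 2) (r : ℝ) :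
    μ.real {U | r ≤ F U - ∫ U', F U' ∂μ} ≤
      Real.exp (2 / 3) * Real.exp (-r / Real.sqrt (2 * (2 * (1 - c))⁻¹ * ∑ x ∈ Δ, δ x ^ 2)) := by
  classical
  haveI : SecondCountableTopology (Matrix (Fin N) (Fin N) ℂ) := inferInstanceAs (SecondCountableTopology (Fin N → Fin N → ℂ))
  haveI : SecondCountableTopology (Matrix.specialUnitaryGroup (Fin N) ℂ) := Topology.IsEmbedding.subtypeVal.secondCountableTopology
  have hW : W.IsAdapted := fun X => ⟨hWdep X, (hWc X).measurable⟩
  have hWb : ∀ X, ∃ C, ∀ U, |W X U| ≤ C := fun X => exists_bound_of_continuous (hWc X)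
  have hγ : IsSpecification (perturbedYM (d := d) (fundamentalRep (Fin N)) (N * β) W supp) :=
    isSpecification_perturbedYM _ (continuous_fundamentalRep (Fin N)) _ hW hWb hsupp
  have hμ' : IsGibbsMeasure (perturbedYM (d := d) (fundamentalRep (Fin N)) (N * β) W supp) μ := hμ
  have hP : ∀ c' : ℝ, variance (fun U => Real.exp (c' * F U)) μ ≤ (2 * (1 - c))⁻¹ *
      ∑ x ∈ Δ, ∫ U, ∫ σ, (Real.exp (c' * F U) - Real.exp (c' * F σ)) ^ 2 ∂(perturbedYM (fundamentalRep (Fin N)) (N * β) W supp {x} U) ∂μ := by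
    intro c'
    obtain ⟨K', hK'⟩ := isLipschitzCylinder_exp_mul hF c'
    exact HeatBathPoincareZd.gibbsVariance_le_onBall hd hN hK hℓs hb hmod hWc hWdep hsupp hosc hosca hlip hlips hΛ hcol hR hc hc1 hrow hμ hK'
  exact gibbs_measureReal_deviation_ge_le hγ hμ' (inv_pos.2 (by linarith)) hF.measurable hF.abs_le hP δ hδ hD r

/-- ★★★ **Lower tail on the ball**: `μ{F − E_μ F ≤ −r} ≤ e^{2/3} exp(−r / √(2(2(1 − c))⁻¹ ∑_{x∈Δ} δ_x²))` for every Gibbs state of every member. [folklore] -/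
theorem gibbs_measureReal_deviation_le_le_onBall (hd : 1 ≤ d) (hN : 1 ≤ N) {β b K a ℓs Λ Λc R c : ℝ} (hK : 0 ≤ K) (hℓs : 0 ≤ ℓs)
    (hb : |β| * (2 * ((d : ℝ) - 1)) ≤ b) (hmod : OneLinkKRModulus N b K)
    {W : Potential (ZdEdge d) (Matrix.specialUnitaryGroup (Fin N) ℂ)} (hWc : ∀ X, Continuous (W X))
    (hWdep : ∀ X, DependsOn (W X) (↑X : Set (ZdEdge d)))
    {supp : Finset (ZdEdge d) → Finset (Finset (ZdEdge d))} (hsupp : W.IsSupportedBy supp)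
    {osc : Finset (ZdEdge d) → ZdEdge d → ℝ} (hosc : ∀ X, Dobrushin.IsOscBound (W X) (osc X))
    (hosca : ∀ e, ∑ X ∈ (supp {e}).filter (fun X => e ∈ X), osc X e ≤ a)
    {lip : Finset (ZdEdge d) → ZdEdge d → ℝ} (hlip : ∀ X, IsLipBound suFrobDist (W X) (lip X))
    (hlips : ∀ e, ∑ X ∈ (supp {e}).filter (fun X => e ∈ X), lip X e ≤ ℓs)
    (hΛ : ∀ e, ∑ y ∈ perturbedNbr supp e, ∑ X ∈ (supp {e}).filter (fun X => e ∈ X), lip X y ≤ Λ)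
    (hcol : ∀ (y : ZdEdge d) (T : Finset (ZdEdge d)), y ∉ T → ∑ e ∈ T, ∑ X ∈ (supp {e}).filter (fun X => e ∈ X), lip X y ≤ Λc)
    (hR : ∀ e, ∀ X ∈ supp {e}, e ∈ X → ∀ y ∈ X, ‖e.1 - y.1‖ ≤ R)
    (hc : 6 * ((d : ℝ) - 1) * |β| * (K * exp a * (1 + 2 * Real.sqrt N * ℓs)) + Real.sqrt N * Λc ≤ c) (hc1 : c < 1)
    (hrow : 6 * ((d : ℝ) - 1) * |β| * (K * exp a * (1 + 2 * Real.sqrt N * ℓs)) + Real.sqrt N * Λ < 1)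
    {μ : Measure (LGConfig d (Matrix.specialUnitaryGroup (Fin N) ℂ))}
    (hμ : μ ∈ perturbedGibbsMeasures (d := d) (fundamentalRep (Fin N)) (N * β) W supp)
    {F : LGConfig d (Matrix.specialUnitaryGroup (Fin N) ℂ) → ℝ} {Δ : Finset (ZdEdge d)} {KF : ℝ≥0}
    (hF : IsLipschitzCylinder (fundamentalRep (Fin N)) F Δ KF) (δ : ZdEdge d → ℝ)
    (hδ : ∀ x ∈ Δ, ∀ U s, |F U - F (update U x s)| ≤ δ x) (hD : 0 < ∑ x ∈ Δ, δ x ^ 2) (r : ℝ) :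
    μ.real {U | F U - ∫ U', F U' ∂μ ≤ -r} ≤
      Real.exp (2 / 3) * Real.exp (-r / Real.sqrt (2 * (2 * (1 - c))⁻¹ * ∑ x ∈ Δ, δ x ^ 2)) := by
  classical
  haveI : SecondCountableTopology (Matrix (Fin N) (Fin N) ℂ) := inferInstanceAs (SecondCountableTopology (Fin N → Fin N → ℂ))
  haveI : SecondCountableTopology (Matrix.specialUnitaryGroup (Fin N) ℂ) := Topology.IsEmbedding.subtypeVal.secondCountableTopology
  have hW : W.IsAdapted := fun X => ⟨hWdep X, (hWc X).measurable⟩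
  have hWb : ∀ X, ∃ C, ∀ U, |W X U| ≤ C := fun X => exists_bound_of_continuous (hWc X)
  have hγ : IsSpecification (perturbedYM (d := d) (fundamentalRep (Fin N)) (N * β) W supp) :=
    isSpecification_perturbedYM _ (continuous_fundamentalRep (Fin N)) _ hW hWb hsupp
  have hμ' : IsGibbsMeasure (perturbedYM (d := d) (fundamentalRep (Fin N)) (N * β) W supp) μ := hμ
  have hP : ∀ c' : ℝ, variance (fun U => Real.exp (c' * F U)) μ ≤ (2 * (1 - c))⁻¹ *
      ∑ x ∈ Δ, ∫ U, ∫ σ, (Real.exp (c' * F U) - Real.exp (c' * F σ)) ^ 2 ∂(perturbedYM (fundamentalRep (Fin N)) (N * β) W supp {x} U) ∂μ := by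
    intro c'
    obtain ⟨K', hK'⟩ := isLipschitzCylinder_exp_mul hF c'
    exact HeatBathPoincareZd.gibbsVariance_le_onBall hd hN hK hℓs hb hmod hWc hWdep hsupp hosc hosca hlip hlips hΛ hcol hR hc hc1 hrow hμ hK'
  exact gibbs_measureReal_deviation_le_le hγ hμ' (inv_pos.2 (by linarith)) hF.measurable hF.abs_le hP δ hδ hD r

/-- ★★ **`SU(2)`, EVERY DIMENSION, QUARTER MODULUS, upper tail** (tree coupling `β_W/2`; `(d−1)β_W/2 ≤ 1`; loads `(a, ℓ_s, Λ, Λc)`, range `R`;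
`c := (3/2)(d−1)β_W e^{a}(1 + 2√2 ℓ_s) + √2 Λc < 1`, `(3/2)(d−1)β_W e^{a}(1 + 2√2 ℓ_s) + √2 Λ < 1`): for every Gibbs state of every member and every Lipschitz cylinder
`F` on `Δ`, `μ{F − E_μ F ≥ r} ≤ e^{2/3} exp(−r / √(2(2(1 − c))⁻¹ ∑_{x∈Δ} δ_x²))`. [folklore] -/
theorem su2_gibbs_measureReal_deviation_ge_le_onBall_quarter (hd : 1 ≤ d) {βW a ℓs Λ Λc R c : ℝ} (h0 : 0 ≤ βW) (hβ : ((d : ℝ) - 1) * βW / 2 ≤ 1)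
    (hℓs : 0 ≤ ℓs) {W : Potential (ZdEdge d) (Matrix.specialUnitaryGroup (Fin 2) ℂ)} (hWc : ∀ X, Continuous (W X))
    (hWdep : ∀ X, DependsOn (W X) (↑X : Set (ZdEdge d)))
    {supp : Finset (ZdEdge d) → Finset (Finset (ZdEdge d))} (hsupp : W.IsSupportedBy supp)
    {osc : Finset (ZdEdge d) → ZdEdge d → ℝ} (hosc : ∀ X, Dobrushin.IsOscBound (W X) (osc X))
    (hosca : ∀ e, ∑ X ∈ (supp {e}).filter (fun X => e ∈ X), osc X e ≤ a)
    {lip : Finset (ZdEdge d) → ZdEdge d → ℝ} (hlip : ∀ X, IsLipBound suFrobDist (W X) (lip X))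
    (hlips : ∀ e, ∑ X ∈ (supp {e}).filter (fun X => e ∈ X), lip X e ≤ ℓs)
    (hΛ : ∀ e, ∑ y ∈ perturbedNbr supp e, ∑ X ∈ (supp {e}).filter (fun X => e ∈ X), lip X y ≤ Λ)
    (hcol : ∀ (y : ZdEdge d) (T : Finset (ZdEdge d)), y ∉ T → ∑ e ∈ T, ∑ X ∈ (supp {e}).filter (fun X => e ∈ X), lip X y ≤ Λc)
    (hR : ∀ e, ∀ X ∈ supp {e}, e ∈ X → ∀ y ∈ X, ‖e.1 - y.1‖ ≤ R)
    (hc : 3 / 2 * ((d : ℝ) - 1) * βW * (exp a * (1 + 2 * Real.sqrt 2 * ℓs)) + Real.sqrt 2 * Λc ≤ c) (hc1 : c < 1)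
    (hrow : 3 / 2 * ((d : ℝ) - 1) * βW * (exp a * (1 + 2 * Real.sqrt 2 * ℓs)) + Real.sqrt 2 * Λ < 1)
    {μ : Measure (LGConfig d (Matrix.specialUnitaryGroup (Fin 2) ℂ))}
    (hμ : μ ∈ perturbedGibbsMeasures (d := d) (fundamentalRep (Fin 2)) (βW / 2) W supp)
    {F : LGConfig d (Matrix.specialUnitaryGroup (Fin 2) ℂ) → ℝ} {Δ : Finset (ZdEdge d)} {KF : ℝ≥0}
    (hF : IsLipschitzCylinder (fundamentalRep (Fin 2)) F Δ KF) (δ : ZdEdge d → ℝ)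
    (hδ : ∀ x ∈ Δ, ∀ U s, |F U - F (update U x s)| ≤ δ x) (hD : 0 < ∑ x ∈ Δ, δ x ^ 2) (r : ℝ) :
    μ.real {U | r ≤ F U - ∫ U', F U' ∂μ} ≤
      Real.exp (2 / 3) * Real.exp (-r / Real.sqrt (2 * (2 * (1 - c))⁻¹ * ∑ x ∈ Δ, δ x ^ 2)) := by
  have hdd : (0 : ℝ) ≤ (d : ℝ) - 1 := by
    have : (1 : ℝ) ≤ d := by exact_mod_cast hd
    linarith
  have habs : |βW / 4| = βW / 4 := abs_of_nonneg (by positivity)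
  have hβ' : ((2 : ℕ) : ℝ) * (βW / 4) = βW / 2 := by push_cast; ring
  have hμ4 : μ ∈ perturbedGibbsMeasures (d := d) (fundamentalRep (Fin 2)) ((2 : ℕ) * (βW / 4)) W supp := by rwa [hβ']
  exact gibbs_measureReal_deviation_ge_le_onBall (N := 2) hd (by norm_num) (β := βW / 4) zero_le_one hℓs (b := ((d : ℝ) - 1) * βW / 2)
    (by rw [habs]; nlinarith) (SlabAreaLawDimensions.su2_oneLinkKRModulus_of_le_one hβ) hWc hWdep hsupp hosc hosca hlip hlips hΛ hcol hR
    (c := c) (by rw [habs]; push_cast; nlinarith [hc]) hc1 (by rw [habs]; push_cast; nlinarith [hrow]) hμ4 hF δ hδ hD r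

/-- ★★ **`SU(2)`, EVERY DIMENSION, QUARTER MODULUS, lower tail**: `μ{F − E_μ F ≤ −r} ≤ e^{2/3} exp(−r / √(2(2(1 − c))⁻¹ ∑_{x∈Δ} δ_x²))`. [folklore] -/
theorem su2_gibbs_measureReal_deviation_le_le_onBall_quarter (hd : 1 ≤ d) {βW a ℓs Λ Λc R c : ℝ} (h0 : 0 ≤ βW) (hβ : ((d : ℝ) - 1) * βW / 2 ≤ 1)
    (hℓs : 0 ≤ ℓs) {W : Potential (ZdEdge d) (Matrix.specialUnitaryGroup (Fin 2) ℂ)} (hWc : ∀ X, Continuous (W X))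
    (hWdep : ∀ X, DependsOn (W X) (↑X : Set (ZdEdge d)))
    {supp : Finset (ZdEdge d) → Finset (Finset (ZdEdge d))} (hsupp : W.IsSupportedBy supp)
    {osc : Finset (ZdEdge d) → ZdEdge d → ℝ} (hosc : ∀ X, Dobrushin.IsOscBound (W X) (osc X))
    (hosca : ∀ e, ∑ X ∈ (supp {e}).filter (fun X => e ∈ X), osc X e ≤ a)
    {lip : Finset (ZdEdge d) → ZdEdge d → ℝ} (hlip : ∀ X, IsLipBound suFrobDist (W X) (lip X))
    (hlips : ∀ e, ∑ X ∈ (supp {e}).filter (fun X => e ∈ X), lip X e ≤ ℓs)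
    (hΛ : ∀ e, ∑ y ∈ perturbedNbr supp e, ∑ X ∈ (supp {e}).filter (fun X => e ∈ X), lip X y ≤ Λ)
    (hcol : ∀ (y : ZdEdge d) (T : Finset (ZdEdge d)), y ∉ T → ∑ e ∈ T, ∑ X ∈ (supp {e}).filter (fun X => e ∈ X), lip X y ≤ Λc)
    (hR : ∀ e, ∀ X ∈ supp {e}, e ∈ X → ∀ y ∈ X, ‖e.1 - y.1‖ ≤ R)
    (hc : 3 / 2 * ((d : ℝ) - 1) * βW * (exp a * (1 + 2 * Real.sqrt 2 * ℓs)) + Real.sqrt 2 * Λc ≤ c) (hc1 : c < 1)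
    (hrow : 3 / 2 * ((d : ℝ) - 1) * βW * (exp a * (1 + 2 * Real.sqrt 2 * ℓs)) + Real.sqrt 2 * Λ < 1)
    {μ : Measure (LGConfig d (Matrix.specialUnitaryGroup (Fin 2) ℂ))}
    (hμ : μ ∈ perturbedGibbsMeasures (d := d) (fundamentalRep (Fin 2)) (βW / 2) W supp)
    {F : LGConfig d (Matrix.specialUnitaryGroup (Fin 2) ℂ) → ℝ} {Δ : Finset (ZdEdge d)} {KF : ℝ≥0}
    (hF : IsLipschitzCylinder (fundamentalRep (Fin 2)) F Δ KF) (δ : ZdEdge d → ℝ)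
    (hδ : ∀ x ∈ Δ, ∀ U s, |F U - F (update U x s)| ≤ δ x) (hD : 0 < ∑ x ∈ Δ, δ x ^ 2) (r : ℝ) :
    μ.real {U | F U - ∫ U', F U' ∂μ ≤ -r} ≤
      Real.exp (2 / 3) * Real.exp (-r / Real.sqrt (2 * (2 * (1 - c))⁻¹ * ∑ x ∈ Δ, δ x ^ 2)) := by
  have hdd : (0 : ℝ) ≤ (d : ℝ) - 1 := by
    have : (1 : ℝ) ≤ d := by exact_mod_cast hd
    linarith
  have habs : |βW / 4| = βW / 4 := abs_of_nonneg (by positivity)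
  have hβ' : ((2 : ℕ) : ℝ) * (βW / 4) = βW / 2 := by push_cast; ring
  have hμ4 : μ ∈ perturbedGibbsMeasures (d := d) (fundamentalRep (Fin 2)) ((2 : ℕ) * (βW / 4)) W supp := by rwa [hβ']
  exact gibbs_measureReal_deviation_le_le_onBall (N := 2) hd (by norm_num) (β := βW / 4) zero_le_one hℓs (b := ((d : ℝ) - 1) * βW / 2)
    (by rw [habs]; nlinarith) (SlabAreaLawDimensions.su2_oneLinkKRModulus_of_le_one hβ) hWc hWdep hsupp hosc hosca hlip hlips hΛ hcol hR
    (c := c) (by rw [habs]; push_cast; nlinarith [hc]) hc1 (by rw [habs]; push_cast; nlinarith [hrow]) hμ4 hF δ hδ hD r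

end Summit.Ventures.YMGap.RobustBall.HeatBathConcentration

end
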